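import Mathlib
import Summits.CriticalPhenomena.PercolationContinuityZ3.Theorems.PercNearOneGluingAdditiveGluingGoodBase
import Summits.CriticalPhenomena.PercolationContinuityZ3.Theorems.PercNearOneGluingAdditiveGluingSigmaGeometry
import HarnessLib

/-! # Crux `PercNearOneGluing.AdditiveGluing` (stmt-CriticalPhenomena-4576), line `subuniform-dead-pocket-maximum`,
# stub `stub_goodStep` — toolkit I: leaf surgery on the singleton fibres and killing the pairs at the observer

Helper file for the crux skeleton `Cruxes/AdditiveGluing/Lines/subuniform-dead-pocket-maximum.lean`
(siege seat k13 on `stub_goodStep`; first of three files: `…GoodStepLeaf`, `…GoodStepFibres`,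
`…GoodStepOneLow`).  Lands with `--supports stmt-CriticalPhenomena-4576`.

Notation: `μ = prodBernoulli w` on `BondConfig (Fin n) = Set (Sym2 (Fin n))`; observer `o`; for `B ∌ o`,
`σ_B = {ω | ∀ z ≠ o, s(o,z) ∈ ω ↔ z ∈ B}` (the open star of `o` is exactly `o–B`); `C(x) = openCluster · x`;
`ρ ω = {e ∈ ω | o ∉ e}` (delete the pairs at `o`); `w⁰` = `w` with every pair at `o` given weight `0`.

## Content (folklore bookkeeping for Kozma–Nitzan arXiv:2401.12397, proof of Thm 5, pp. 13–14)

* Leaf surgery on `σ_{y}` (`goodStepK13_leaf_*`, via `sigmaGeometry_walk_cut` with `O = {o}`, `S = {y}`): for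
  `u, v ≠ o`, `u ↔ v` in `ω` iff in `ρ ω`; `o ↔ v` in `ω` iff `y ↔ v` in `ρ ω`; `C_ω(o) = {o} ∪ C_{ρω}(y)`; hence
  `σ_{y} ∩ {a ↔ b} = σ_{y} ∩ ρ⁻¹{a ↔ b}`, `σ_{y} ∩ {o ↔ b} = σ_{y} ∩ ρ⁻¹{y ↔ b}`,
  `σ_{y} ∩ ρ⁻¹{C(y) = W'} = σ_{y} ∩ {C(o) = W' ∪ {o}}` (`o ∉ W'`), and `ρ⁻¹{C(y) = W'} = ∅` if `o ∈ W'`;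
  also `ρ⁻¹{u ↔ v} = {u ↔ v in {o}ᶜ}` and `ρ⁻¹{u ↔ v in S} ⊆ {u ↔ v in S ∖ {o}}` for `u ≠ o`.
* Measure bookkeeping: `μ(σ_B ∩ ρ⁻¹E) = μ(σ_B) · μ(ρ⁻¹E)` (`goodStepK13_real_fibre_preimage`, disjoint supports);
  `μ_{w⁰}(E) = μ_w(ρ⁻¹E)` for every event (`goodStepK13_real_kill`: `ρ = id` a.s. under `w⁰`, and `ρ⁻¹E` lives
  off `o` where `w⁰ = w`); `w⁰` has fewer positive-degree vertices than `w` when `o` has a positive-weight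
  non-loop pair (`goodStepK13_card_lt`) — the measure decrease used by the induction of the line.

No new definitions (`ρ`, `σ_B`, `w⁰` are spelled out / characterised by hypotheses). -/

namespace Summit.CriticalPhenomena.PercolationContinuityZ3.Theorems

open MeasureTheory Set
open Literature.Probability.LatticeModels (prodBernoulli)
open Literature.Probability.Percolation (BondConfig openConn openConnIn openGraph openCluster
  openGraph_adj DeterminedBy determinedBy_iff PathIn)

noncomputable section
open Classical

variable {n : ℕ}

/-! ### Leaf geometry: on `σ_{y}` the observer hangs off `y` -/

/-- A vertex reached from `u` in the configuration with the pairs at `o` deleted is reached from `u`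
inside `{o}ᶜ`, provided `u ≠ o`. [folklore] -/
theorem goodStepK13_pathIn_of_reachable_del (o : Fin n) {ω : BondConfig (Fin n)} {u v : Fin n} (hu : u ≠ o)
    (h : (openGraph {e ∈ ω | o ∉ e}).Reachable u v) :
    PathIn (openGraph ω) (({o} : Set (Fin n))ᶜ) u v := by
  rw [SimpleGraph.reachable_iff_reflTransGen] at h
  induction h with
  | refl => exact PathIn.refl (Set.mem_compl_singleton_iff.2 hu)
  | @tail c d _ hcd ih =>
    have h' := (openGraph_adj _ _ _).1 hcd
    have hmem : s(c, d) ∈ ω ∧ o ∉ s(c, d) := h'.1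
    refine ih.tail ((openGraph_adj _ _ _).2 ⟨hmem.1, h'.2⟩) (Set.mem_compl_singleton_iff.2 ?_)
    intro hdo
    exact hmem.2 (hdo ▸ Sym2.mem_mk_right c d)

/-- A path inside a set `S` from `u ≠ o`, in the configuration with the pairs at `o` deleted, is a path
inside `S ∖ {o}` of the original configuration. [folklore] -/
theorem goodStepK13_pathIn_diff_of_pathIn_del (o : Fin n) {ω : BondConfig (Fin n)} {S : Set (Fin n)}
    {u v : Fin n} (hu : u ≠ o) (h : PathIn (openGraph {e ∈ ω | o ∉ e}) S u v) :
    PathIn (openGraph ω) (S \ {o}) u v := by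
  obtain ⟨huS, h⟩ := h
  induction h with
  | refl => exact PathIn.refl ⟨huS, hu⟩
  | @tail c d _ hcd ih =>
    have h' := (openGraph_adj _ _ _).1 hcd.1
    have hmem : s(c, d) ∈ ω ∧ o ∉ s(c, d) := h'.1
    refine ih.tail ((openGraph_adj _ _ _).2 ⟨hmem.1, h'.2⟩) ⟨hcd.2, ?_⟩
    intro hdo
    exact hmem.2 ((Set.mem_singleton_iff.1 hdo) ▸ Sym2.mem_mk_right c d)

/-- A path inside `{o}ᶜ` uses no pair at `o`, hence survives the deletion of the pairs at `o`.
[folklore] -/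
theorem goodStepK13_reachable_del_of_pathIn (o : Fin n) {ω : BondConfig (Fin n)} {u v : Fin n}
    (h : PathIn (openGraph ω) (({o} : Set (Fin n))ᶜ) u v) :
    (openGraph {e ∈ ω | o ∉ e}).Reachable u v := by
  refine Literature.Probability.Percolation.DCT16.reachable_of_pathIn
    (Literature.Probability.Percolation.DCT16.pathIn_congrGraph (fun c d hc hd hcd => ?_) h)
  have h' := (openGraph_adj _ _ _).1 hcd
  refine (openGraph_adj _ _ _).2 ⟨⟨h'.1, fun ho => ?_⟩, h'.2⟩
  rcases Sym2.mem_iff.1 ho with rfl | rfl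
  · exact hc rfl
  · exact hd rfl

/-- **`ρ⁻¹{u ↔ v} = {u ↔ v in {o}ᶜ}`** for `u, v ≠ o`, where `ρ` deletes the pairs at `o`. [folklore] -/
theorem goodStepK13_preimage_del_openConn (o u v : Fin n) (hu : u ≠ o) :
    (fun ω : BondConfig (Fin n) => {e ∈ ω | o ∉ e}) ⁻¹' openConn u v =
      openConnIn (({o} : Set (Fin n))ᶜ) u v := by
  ext ω
  simp only [Set.mem_preimage]
  constructor
  · intro h
    exact Literature.Probability.Percolation.DCT16.mem_openConnIn_of_pathIn
      (goodStepK13_pathIn_of_reachable_del o hu h)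
  · intro h
    exact goodStepK13_reachable_del_of_pathIn o
      (Literature.Probability.Percolation.DCT16.pathIn_of_mem_openConnIn h)

/-- `ρ⁻¹{u ↔ v in S} ⊆ {u ↔ v in S ∖ {o}}` for `u ≠ o`. [folklore] -/
theorem goodStepK13_preimage_del_openConnIn_subset (o : Fin n) (S : Set (Fin n)) (u v : Fin n) (hu : u ≠ o) :
    (fun ω : BondConfig (Fin n) => {e ∈ ω | o ∉ e}) ⁻¹' openConnIn S u v ⊆ openConnIn (S \ {o}) u v := by
  intro ω h
  exact Literature.Probability.Percolation.DCT16.mem_openConnIn_of_pathIn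
    (goodStepK13_pathIn_diff_of_pathIn_del o hu
      (Literature.Probability.Percolation.DCT16.pathIn_of_mem_openConnIn h))

/-- The vertex `o` is isolated after deleting its pairs: it is not reached from `y ≠ o`. [folklore] -/
theorem goodStepK13_not_reachable_del (o y : Fin n) (hy : y ≠ o) (ω : BondConfig (Fin n)) :
    ¬ (openGraph {e ∈ ω | o ∉ e}).Reachable y o := by
  intro h
  obtain ⟨z, -, hz, -⟩ := goodBase_exists_open_pair h.symm hy
  exact hz.2 (Sym2.mem_mk_left o z)

/-- **Leaf surgery on `σ_{y}`.**  If the open pairs at `o` are exactly `{o–y}` then, with `ρ ω` the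
configuration with the pairs at `o` deleted: (i) for `u, v ≠ o`, `u ↔ v` in `ω` iff `u ↔ v` in `ρ ω`;
(ii) for `v ≠ o`, `o ↔ v` in `ω` iff `y ↔ v` in `ρ ω`.  (Cut an open walk at its visits to the leaf
`o`: `sigmaGeometry_walk_cut` with `O = {o}`, `S = {y}`.) [folklore] -/
theorem goodStepK13_leaf_reachable (o y : Fin n) (hy : y ≠ o) {ω : BondConfig (Fin n)}
    (hσ : ∀ z : Fin n, z ≠ o → (s(o, z) ∈ ω ↔ z ∈ ({y} : Finset (Fin n)))) :
    (∀ u v : Fin n, u ≠ o → v ≠ o →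
        ((openGraph ω).Reachable u v ↔ (openGraph {e ∈ ω | o ∉ e}).Reachable u v)) ∧
      (∀ v : Fin n, v ≠ o →
        ((openGraph ω).Reachable o v ↔ (openGraph {e ∈ ω | o ∉ e}).Reachable y v)) := by
  have hGH : ∀ c d : Fin n, (openGraph ω).Adj c d → c ∉ ({o} : Finset (Fin n)) →
      d ∉ ({o} : Finset (Fin n)) → (openGraph {e ∈ ω | o ∉ e}).Adj c d := by
    intro c d hcd hc hd
    rw [Finset.mem_singleton] at hc hd
    have h' := (openGraph_adj _ _ _).1 hcd
    refine (openGraph_adj _ _ _).2 ⟨⟨h'.1, fun ho => ?_⟩, h'.2⟩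
    rcases Sym2.mem_iff.1 ho with rfl | rfl
    · exact hc rfl
    · exact hd rfl
  have hSS : ∀ c d : Fin n, c ∈ ({y} : Finset (Fin n)) → d ∈ ({y} : Finset (Fin n)) → c ≠ d →
      (openGraph {e ∈ ω | o ∉ e}).Adj c d := by
    intro c d hc hd hcd
    rw [Finset.mem_singleton] at hc hd
    exact absurd (hc.trans hd.symm) hcd
  have hOS : ∀ c d : Fin n, (openGraph ω).Adj c d → c ∈ ({o} : Finset (Fin n)) →
      d ∉ ({o} : Finset (Fin n)) → d ∈ ({y} : Finset (Fin n)) := by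
    intro c d hcd hc hd
    rw [Finset.mem_singleton] at hc hd
    subst hc
    have h' := (openGraph_adj _ _ _).1 hcd
    exact (hσ d hd).1 h'.1
  have hmono : openGraph {e ∈ ω | o ∉ e} ≤ openGraph ω := by
    intro c d hcd
    have h' := (openGraph_adj _ _ _).1 hcd
    exact (openGraph_adj _ _ _).2 ⟨h'.1.1, h'.2⟩
  have hoy : (openGraph ω).Adj o y := (openGraph_adj _ _ _).2 ⟨(hσ y hy).2 (Finset.mem_singleton_self y), hy.symm⟩
  refine ⟨fun u v hu hv => ⟨fun h => ?_, fun h => h.mono hmono⟩, fun v hv => ⟨fun h => ?_, fun h => ?_⟩⟩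
  · obtain ⟨wk⟩ := h
    exact (sigmaGeometry_walk_cut hGH hSS hOS wk (by rwa [Finset.mem_singleton])).1
      (by rwa [Finset.mem_singleton])
  · obtain ⟨wk⟩ := h
    obtain ⟨s, hs, hsv⟩ := (sigmaGeometry_walk_cut hGH hSS hOS wk (by rwa [Finset.mem_singleton])).2
      (Finset.mem_singleton_self o)
    rw [Finset.mem_singleton] at hs
    subst hs
    exact hsv
  · exact hoy.reachable.trans (h.mono hmono)

/-- On `σ_{y}`: `σ_{y} ∩ {u ↔ v} = σ_{y} ∩ ρ⁻¹{u ↔ v}` for `u, v ≠ o`. [folklore] -/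
theorem goodStepK13_leaf_inter_openConn (o y u v : Fin n) (hy : y ≠ o) (hu : u ≠ o) (hv : v ≠ o) :
    {ω : BondConfig (Fin n) | ∀ z : Fin n, z ≠ o → (s(o, z) ∈ ω ↔ z ∈ ({y} : Finset (Fin n)))} ∩
        openConn u v =
      {ω : BondConfig (Fin n) | ∀ z : Fin n, z ≠ o → (s(o, z) ∈ ω ↔ z ∈ ({y} : Finset (Fin n)))} ∩
        (fun ω : BondConfig (Fin n) => {e ∈ ω | o ∉ e}) ⁻¹' openConn u v := by
  ext ω
  simp only [Set.mem_inter_iff, Set.mem_setOf_eq, Set.mem_preimage]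
  constructor
  · rintro ⟨hσ, h⟩
    exact ⟨hσ, ((goodStepK13_leaf_reachable o y hy hσ).1 u v hu hv).1 h⟩
  · rintro ⟨hσ, h⟩
    exact ⟨hσ, ((goodStepK13_leaf_reachable o y hy hσ).1 u v hu hv).2 h⟩

/-- On `σ_{y}`: `σ_{y} ∩ {o ↔ v} = σ_{y} ∩ ρ⁻¹{y ↔ v}` for `v ≠ o`. [folklore] -/
theorem goodStepK13_leaf_inter_openConn_obs (o y v : Fin n) (hy : y ≠ o) (hv : v ≠ o) :
    {ω : BondConfig (Fin n) | ∀ z : Fin n, z ≠ o → (s(o, z) ∈ ω ↔ z ∈ ({y} : Finset (Fin n)))} ∩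
        openConn o v =
      {ω : BondConfig (Fin n) | ∀ z : Fin n, z ≠ o → (s(o, z) ∈ ω ↔ z ∈ ({y} : Finset (Fin n)))} ∩
        (fun ω : BondConfig (Fin n) => {e ∈ ω | o ∉ e}) ⁻¹' openConn y v := by
  ext ω
  simp only [Set.mem_inter_iff, Set.mem_setOf_eq, Set.mem_preimage]
  constructor
  · rintro ⟨hσ, h⟩
    exact ⟨hσ, ((goodStepK13_leaf_reachable o y hy hσ).2 v hv).1 h⟩
  · rintro ⟨hσ, h⟩
    exact ⟨hσ, ((goodStepK13_leaf_reachable o y hy hσ).2 v hv).2 h⟩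

/-- On `σ_{y}` the cluster of the observer is its leaf edge plus the cluster of `y` off `o`:
`C_ω(o) = {o} ∪ C_{ρ ω}(y)`. [folklore] -/
theorem goodStepK13_leaf_cluster (o y : Fin n) (hy : y ≠ o) {ω : BondConfig (Fin n)}
    (hσ : ∀ z : Fin n, z ≠ o → (s(o, z) ∈ ω ↔ z ∈ ({y} : Finset (Fin n)))) :
    openCluster ω o = insert o (openCluster {e ∈ ω | o ∉ e} y) := by
  ext x
  simp only [openCluster, Set.mem_setOf_eq, Set.mem_insert_iff]
  constructor
  · intro h
    by_cases hx : x = o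
    · exact Or.inl hx
    · exact Or.inr (((goodStepK13_leaf_reachable o y hy hσ).2 x hx).1 h)
  · rintro (rfl | h)
    · exact SimpleGraph.Reachable.refl _
    · have hx : x ≠ o := fun hxo => goodStepK13_not_reachable_del o y hy ω (hxo ▸ h)
      exact ((goodStepK13_leaf_reachable o y hy hσ).2 x hx).2 h

/-- On `σ_{y}`, for `o ∉ W'`: `σ_{y} ∩ ρ⁻¹{C(y) = W'} = σ_{y} ∩ {C(o) = W' ∪ {o}}`. [folklore] -/
theorem goodStepK13_leaf_inter_cluster (o y : Fin n) (hy : y ≠ o) (W' : Finset (Fin n)) (hoW : o ∉ W') :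
    {ω : BondConfig (Fin n) | ∀ z : Fin n, z ≠ o → (s(o, z) ∈ ω ↔ z ∈ ({y} : Finset (Fin n)))} ∩
        (fun ω : BondConfig (Fin n) => {e ∈ ω | o ∉ e}) ⁻¹'
          {η : BondConfig (Fin n) | openCluster η y = (W' : Set (Fin n))} =
      {ω : BondConfig (Fin n) | ∀ z : Fin n, z ≠ o → (s(o, z) ∈ ω ↔ z ∈ ({y} : Finset (Fin n)))} ∩
        {ω : BondConfig (Fin n) | openCluster ω o = ((insert o W' : Finset (Fin n)) : Set (Fin n))} := by
  ext ω
  simp only [Set.mem_inter_iff, Set.mem_setOf_eq, Set.mem_preimage]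
  constructor
  · rintro ⟨hσ, h⟩
    refine ⟨hσ, ?_⟩
    rw [goodStepK13_leaf_cluster o y hy hσ, h, Finset.coe_insert]
  · rintro ⟨hσ, h⟩
    refine ⟨hσ, ?_⟩
    have hno : o ∉ openCluster {e ∈ ω | o ∉ e} y := goodStepK13_not_reachable_del o y hy ω
    have key : insert o (openCluster {e ∈ ω | o ∉ e} y) = insert o (W' : Set (Fin n)) := by
      rw [← goodStepK13_leaf_cluster o y hy hσ, h, Finset.coe_insert]
    have h1 : openCluster {e ∈ ω | o ∉ e} y = insert o (openCluster {e ∈ ω | o ∉ e} y) \ {o} := by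
      rw [Set.insert_sdiff_self_of_notMem hno]
    rw [h1, key, Set.insert_sdiff_self_of_notMem (fun h' => hoW (Finset.mem_coe.1 h'))]

/-- `ρ⁻¹{C(y) = W'} = ∅` when `o ∈ W'` and `y ≠ o`: after deleting the pairs at `o`, the cluster of
`y` avoids `o`. [folklore] -/
theorem goodStepK13_preimage_cluster_empty (o y : Fin n) (hy : y ≠ o) (W' : Finset (Fin n)) (hoW : o ∈ W') :
    (fun ω : BondConfig (Fin n) => {e ∈ ω | o ∉ e}) ⁻¹'
        {η : BondConfig (Fin n) | openCluster η y = (W' : Set (Fin n))} = ∅ := by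
  ext ω
  simp only [Set.mem_preimage, Set.mem_setOf_eq, Set.mem_empty_iff_false, iff_false]
  intro h
  have : o ∈ openCluster {e ∈ ω | o ∉ e} y := by
    rw [h]
    exact Finset.mem_coe.2 hoW
  exact goodStepK13_not_reachable_del o y hy ω this

/-! ### Measure bookkeeping: killing the pairs at `o` -/

/-- `σ_B` is determined by the pairs containing `o`. [folklore] -/
theorem goodStepK13_determinedBy_sigma (o : Fin n) (B : Finset (Fin n)) :
    DeterminedBy {ω : BondConfig (Fin n) | ∀ z : Fin n, z ≠ o → (s(o, z) ∈ ω ↔ z ∈ B)}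
      (↑(Finset.univ.filter fun e : Sym2 (Fin n) => o ∈ e) : Set (Sym2 (Fin n))) := by
  rw [determinedBy_iff]
  intro ω ω' h
  simp only [Set.mem_setOf_eq]
  refine forall₂_congr fun z _ => ?_
  have he : s(o, z) ∈ (↑(Finset.univ.filter fun e : Sym2 (Fin n) => o ∈ e) : Set (Sym2 (Fin n))) := by
    rw [Finset.coe_filter]
    exact ⟨Finset.mem_univ _, Sym2.mem_mk_left o z⟩
  have key : s(o, z) ∈ ω ↔ s(o, z) ∈ ω' :=
    ⟨fun h1 => ((Set.ext_iff.1 h _).1 ⟨h1, he⟩).1, fun h1 => ((Set.ext_iff.1 h _).2 ⟨h1, he⟩).1⟩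
  rw [key]

/-- A `ρ`-preimage is determined by the pairs avoiding `o`. [folklore] -/
theorem goodStepK13_determinedBy_preimage (o : Fin n) (E : Set (BondConfig (Fin n))) :
    DeterminedBy ((fun ω : BondConfig (Fin n) => {e ∈ ω | o ∉ e}) ⁻¹' E)
      (↑(Finset.univ.filter fun e : Sym2 (Fin n) => o ∈ e) : Set (Sym2 (Fin n)))ᶜ := by
  rw [determinedBy_iff]
  intro ω ω' h
  simp only [Set.mem_preimage]
  have key : {e ∈ ω | o ∉ e} = {e ∈ ω' | o ∉ e} := by
    ext e
    simp only [Set.mem_setOf_eq]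
    have hc : o ∉ e → (e ∈ (↑(Finset.univ.filter fun e : Sym2 (Fin n) => o ∈ e) : Set (Sym2 (Fin n)))ᶜ) := by
      intro hoe
      rw [Set.mem_compl_iff, Finset.coe_filter]
      exact fun h' => hoe h'.2
    constructor
    · rintro ⟨heω, hoe⟩
      exact ⟨((Set.ext_iff.1 h e).1 ⟨heω, hc hoe⟩).1, hoe⟩
    · rintro ⟨heω, hoe⟩
      exact ⟨((Set.ext_iff.1 h e).2 ⟨heω, hc hoe⟩).1, hoe⟩
  rw [key]

/-- **Fibre factorisation**: `μ(σ_B ∩ ρ⁻¹E) = μ(σ_B) · μ(ρ⁻¹E)` (disjoint supports). [folklore] -/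
theorem goodStepK13_real_fibre_preimage (w : Sym2 (Fin n) → unitInterval) (o : Fin n) (B : Finset (Fin n))
    (E : Set (BondConfig (Fin n))) :
    (prodBernoulli w).real
        ({ω : BondConfig (Fin n) | ∀ z : Fin n, z ≠ o → (s(o, z) ∈ ω ↔ z ∈ B)} ∩
          (fun ω : BondConfig (Fin n) => {e ∈ ω | o ∉ e}) ⁻¹' E) =
      (prodBernoulli w).real {ω : BondConfig (Fin n) | ∀ z : Fin n, z ≠ o → (s(o, z) ∈ ω ↔ z ∈ B)} *
        (prodBernoulli w).real ((fun ω : BondConfig (Fin n) => {e ∈ ω | o ∉ e}) ⁻¹' E) :=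
  Literature.Probability.LatticeModels.prodBernoulli_real_inter_of_determinedBy w
    (Finset.univ.filter fun e : Sym2 (Fin n) => o ∈ e) (goodStepK13_determinedBy_sigma o B)
    (goodStepK13_determinedBy_preimage o E) (Set.toFinite _).measurableSet (Set.toFinite _).measurableSet

/-- **Killing the pairs at `o`**: if `w⁰` vanishes on the pairs at `o` and agrees with `w` elsewhere, then
`μ_{w⁰}(E) = μ_w(ρ⁻¹E)` for every event `E` (`ρ = id` `μ_{w⁰}`-a.s., and `ρ⁻¹E` lives off `o`).
[folklore] -/
theorem goodStepK13_real_kill (w w0 : Sym2 (Fin n) → unitInterval) (o : Fin n)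
    (hw0 : ∀ e, o ∈ e → w0 e = 0) (hw0' : ∀ e, o ∉ e → w0 e = w e) (E : Set (BondConfig (Fin n))) :
    (prodBernoulli w0).real E =
      (prodBernoulli w).real ((fun ω : BondConfig (Fin n) => {e ∈ ω | o ∉ e}) ⁻¹' E) := by
  -- the event "no open pair at o" is conull under w0
  have hnull : (prodBernoulli w0).real {ω : BondConfig (Fin n) | ∃ e ∈ ω, o ∈ e} = 0 := by
    refine sigmaRec_null w0 _ (Finset.univ.filter fun e : Sym2 (Fin n) => o ∈ e)
      (fun e he => hw0 e (Finset.mem_filter.1 he).2) fun ω hω => ?_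
    obtain ⟨e, heω, hoe⟩ := hω
    exact ⟨e, Finset.mem_filter.2 ⟨Finset.mem_univ _, hoe⟩, heω⟩
  have hKc : prodBernoulli w0 {ω : BondConfig (Fin n) | ∀ e ∈ ω, o ∉ e}ᶜ = 0 := by
    have hset : {ω : BondConfig (Fin n) | ∀ e ∈ ω, o ∉ e}ᶜ = {ω : BondConfig (Fin n) | ∃ e ∈ ω, o ∈ e} := by
      ext ω
      simp only [Set.mem_compl_iff, Set.mem_setOf_eq, not_forall, not_not, exists_prop]
    rw [hset]
    exact (measureReal_eq_zero_iff (measure_ne_top _ _)).1 hnull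
  have h1 : (prodBernoulli w0).real (Set.univ ∩ E) =
      (prodBernoulli w0).real (Set.univ ∩ (fun ω : BondConfig (Fin n) => {e ∈ ω | o ∉ e}) ⁻¹' E) := by
    refine sigmaRec_inter_congr w0 hKc fun ω _ hK => ?_
    have hfix : {e ∈ ω | o ∉ e} = ω := by
      ext e
      simp only [Set.mem_setOf_eq]
      exact ⟨fun h => h.1, fun h => ⟨h, hK e h⟩⟩
    simp only [Set.mem_preimage, hfix]
  rw [Set.univ_inter, Set.univ_inter] at h1
  rw [h1]
  refine Literature.Probability.LatticeModels.prodBernoulli_real_eq_of_determinedBy w0 w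
    (F := (↑(Finset.univ.filter fun e : Sym2 (Fin n) => o ∈ e) : Set (Sym2 (Fin n)))ᶜ) (fun e he => ?_)
    (goodStepK13_determinedBy_preimage o E) (Set.toFinite _).measurableSet
  rw [Set.mem_compl_iff, Finset.coe_filter] at he
  exact hw0' e fun hoe => he ⟨Finset.mem_univ _, hoe⟩

/-- `w⁰` has fewer positive-degree vertices than `w` when `o` has a positive-weight non-loop pair.
[folklore] -/
theorem goodStepK13_card_lt (w w0 : Sym2 (Fin n) → unitInterval) (o y : Fin n)
    (hw0 : ∀ e, o ∈ e → w0 e = 0) (hw0' : ∀ e, o ∉ e → w0 e = w e)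
    (hpos : (w s(o, y) : ℝ) ≠ 0) :
    (Finset.univ.filter (fun v : Fin n => ∃ u : Fin n, 0 < (w0 s(u, v) : ℝ))).card
      < (Finset.univ.filter (fun v : Fin n => ∃ u : Fin n, 0 < (w s(u, v) : ℝ))).card := by
  apply Finset.card_lt_card
  rw [Finset.ssubset_iff_of_subset]
  · refine ⟨o, Finset.mem_filter.2 ⟨Finset.mem_univ _, y, ?_⟩, fun h => ?_⟩
    · have h0 : (0 : ℝ) ≤ w s(y, o) := unitInterval.nonneg _
      rw [Sym2.eq_swap] at hpos
      exact lt_of_le_of_ne h0 (Ne.symm hpos)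
    · obtain ⟨u, hu⟩ := (Finset.mem_filter.1 h).2
      rw [hw0 _ (Sym2.mem_mk_right u o)] at hu
      simp at hu
  · intro v hv
    obtain ⟨u, hu⟩ := (Finset.mem_filter.1 hv).2
    refine Finset.mem_filter.2 ⟨Finset.mem_univ _, u, ?_⟩
    by_cases ho : o ∈ s(u, v)
    · rw [hw0 _ ho] at hu
      simp at hu
    · rwa [hw0' _ ho] at hu

/-- Registered form (`stub_goodStepKill_k13` on stmt-CriticalPhenomena-4576) of `goodStepK13_real_kill`:
killing the pairs at `o` turns every probability into the `w`-probability of the `ρ`-preimage. [folklore] -/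
theorem stub_goodStepKill_k13 :
    ∀ (n : ℕ) (w w0 : Sym2 (Fin n) → unitInterval) (o : Fin n), (∀ e, o ∈ e → w0 e = 0) → (∀ e, o ∉ e → w0
      e = w e) → ∀ (E : Set (BondConfig (Fin n))), (prodBernoulli w0).real E = (prodBernoulli w).real ((fun
      ω : BondConfig (Fin n) => {e ∈ ω | o ∉ e}) ⁻¹' E) :=
  fun _ w w0 o hw0 hw0' E => goodStepK13_real_kill w w0 o hw0 hw0' E

end

end Summit.CriticalPhenomena.PercolationContinuityZ3.Theorems
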